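import Summits.QuantumFields.BalabanUV.T4Continuum.Support.TermwiseCouplingMismatch
import Literature.MathematicalPhysics.QuantumFieldTheory.Balaban1983to89.T4EtaRateMin

/-!
# TermwiseCouplingMismatchNE3 — input (γ3) of leaf S.4's split READ FROM ROW NE3's TYPED OUTPUT `LocalRate` through a
# displayed liaison, exactly as the E-kind reads NE3 through `T4RateLiaison.GaugeDominated`

Cell `pub-balaban`, rung (B)+1 sub-cell t4, lineage `b2b-balaban-t4-ne7-p1` (node U5 = NE7, TERM-WISE member;
generation 18), companion of `Support/TermwiseCouplingMismatch` (p206498), skeleton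
`HOME/t4/b2b-balaban-t4-ne7-p1-g18/SKELETON-NE7-P1.md` §2 leaf S.4 (γ3), record `t4/T4-EST-NE7-P1.md` §24.  HONEST FRAMING
(page 1): FIXED FINITE T⁴, rung (B)+1 = the `ε → 0` limit of unit-scale averaged expectations, CONDITIONAL on BetaPertH
and the nine spine estimates (0/9 proved); NOT infinite volume, NOT a mass gap, NOT the Clay problem.  NE7 and NE3 are
NOT PRINTED in [Balaban1984PropagatorsI]–[Balaban1989LargeFieldII] and NOT proved here: `T4EtaRateMin.LocalRate` is row
NE3's HYPOTHESIS SHAPE (template King (3.71)), the liaison below is a displayed binder (node U1a's unprinted convention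
«which local quantities the readings are», cell GAPS G-t4-U1a-2), nothing printed is asserted.  [folklore] bookkeeping;
no definitions, no cite tags.

WHY.  `TermwiseCouplingMismatch.couplingMismatch_radius` produces the END's binder (γ) from four inputs; three of them are
located one-run ∕ row NE4 ∕ bookkeeping, and the fourth, (γ3) «two-run fine-action closeness per block between run B's
minimiser and the lift of run A's minimiser, `Σ_y |S_B(y) − S_L(y)| ≤ vol·eK_K`», was left as a NAMED ASK of row NE3.
Row NE3's typed output is `LocalRate R C₃ θ₃`: consecutive runs' LOCAL READINGS differ by `≤ C₃θ₃^K` at every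
unit-scale site.  The E-kind consumes it through the liaison `GaugeDominated` (`T4TowerRateDischarge.closeness_of_
localRate`); this file states the parallel liaison for plaquette-energy block sums — RELATIVE form: the two-run
difference of the block sums is dominated by (run B's one-run action scale on the support, `vol·cA_K`) × (a constant
`Crel`) × (any uniform bound of the local-reading discrepancy) — and composes.  After it, (γ3) = row NE3's `LocalRate`
BY NAME + the liaison binder `hdom` ([dict] over NODE O, the same status as `GaugeDominated`).

WHAT IS PROVED ([folklore]).
§1 `blockClose_of_localRate` — `LocalRate` + the liaison ⇒ the hypothesis `he` of `couplingMismatch_radius` with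
   `eK_K = cA_K·Crel·(C₃·θ₃^K)`; `eK_le_poly_geometric` — its polynomial × geometric majorant when `cA_K ≤ CA·(K+1)^p`.
§2 **`couplingMismatch_radius_of_localRate`** — (γ) PRODUCED with (γ3) read from row NE3: `|γ_B − γ_A| ≤ vol·rγ_K`,
   `rγ_K = (ι_K + d_K)·cA_K + W_K·(cA_K·Crel·(C₃θ₃^K) + dK_K)`, on row NE3's admissible data `R.dom`.
NOT NE7, NOT NE3, NOT summit progress.
-/

noncomputable section

open Finset
open scoped BigOperators

namespace Summit.QuantumFields.BalabanUV.T4Continuum.TermwiseCouplingMismatch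

open Literature.MathematicalPhysics.QuantumFieldTheory.Balaban1983to89
open T4EtaRateMin (Readings LocalRate)

section NE3

variable {X Y : Type*} [DecidableEq Y] {ι' : Type} {Z : Type*} {σ : Type*} [DecidableEq σ] {l₀ vol w₀ : ℝ}
  {T : ℕ → Finset σ} {Bad : ℕ → ℝ → Finset σ}

/-- **(γ3) FROM ROW NE3.**  Row NE3's `LocalRate R C₃ θ₃` (local readings of consecutive runs differ by `≤ C₃θ₃^K` at
every unit-scale site, uniformly in the admissible datum) and the LIAISON `hdom` (the two-run difference of the weighted
block sums of plaquette energies on the coupling-mismatch support is dominated by `vol·cA_K·Crel` times any uniform bound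
of the local-reading discrepancy — a displayed binder, node U1a's convention) give the hypothesis `he` of
`couplingMismatch_radius` with `eK_K = cA_K·Crel·(C₃·θ₃^K)`. [folklore] -/
theorem blockClose_of_localRate (R : Readings ι' Z) {C₃ θ₃ Crel : ℝ} (hloc : LocalRate R C₃ θ₃)
    (PX : ℕ → ℝ → σ → ι' → Finset X) (PY : ℕ → ℝ → σ → ι' → Finset Y) (blk : ℕ → ℝ → σ → ι' → X → Y)
    (ρB ρL : ℕ → ℝ → σ → ι' → X → ℝ) {cA : ℕ → ℝ}
    (hdom : ∀ K t, |t| ≤ l₀ → ∀ τ ∈ T K \ Bad K t, ∀ v ∈ R.dom, ∀ Mloc : ℝ,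
      (∀ z : Z, |R.loc (K + 1) v z - R.loc K v z| ≤ Mloc) →
        ∑ y ∈ PY K t τ v, |(∑ x ∈ PX K t τ v with blk K t τ v x = y, ρB K t τ v x)
          - ∑ x ∈ PX K t τ v with blk K t τ v x = y, ρL K t τ v x| ≤ vol * cA K * Crel * Mloc) :
    ∀ K t, |t| ≤ l₀ → ∀ τ ∈ T K \ Bad K t, ∀ v ∈ R.dom,
      ∑ y ∈ PY K t τ v, |(∑ x ∈ PX K t τ v with blk K t τ v x = y, ρB K t τ v x)
        - ∑ x ∈ PX K t τ v with blk K t τ v x = y, ρL K t τ v x| ≤ vol * (cA K * Crel * (C₃ * θ₃ ^ K)) := by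
  intro K t ht τ hτ v hv
  have h := hdom K t ht τ hτ v hv (C₃ * θ₃ ^ K) (fun z => hloc K v hv z)
  calc _ ≤ vol * cA K * Crel * (C₃ * θ₃ ^ K) := h
    _ = vol * (cA K * Crel * (C₃ * θ₃ ^ K)) := by ring

/-- The produced `eK_K = cA_K·Crel·(C₃θ₃^K)` is polynomial × geometric when run B's action scale is polynomial,
`cA_K ≤ CA·(K+1)^p` — the shape `summable_couplingRadius` takes. [folklore] -/
theorem eK_le_poly_geometric {cA : ℕ → ℝ} {CA Crel C₃ θ₃ : ℝ} {p : ℕ} (hcA : ∀ K, cA K ≤ CA * ((K : ℝ) + 1) ^ p)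
    (hCrel : 0 ≤ Crel) (hC₃ : 0 ≤ C₃) (hθ₃ : 0 ≤ θ₃) (K : ℕ) :
    cA K * Crel * (C₃ * θ₃ ^ K) ≤ (CA * Crel * C₃) * ((K : ℝ) + 1) ^ p * θ₃ ^ K := by
  have h1 : 0 ≤ Crel * (C₃ * θ₃ ^ K) := by positivity
  calc cA K * Crel * (C₃ * θ₃ ^ K) = cA K * (Crel * (C₃ * θ₃ ^ K)) := by ring
    _ ≤ (CA * ((K : ℝ) + 1) ^ p) * (Crel * (C₃ * θ₃ ^ K)) := mul_le_mul_of_nonneg_right (hcA K) h1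
    _ = (CA * Crel * C₃) * ((K : ℝ) + 1) ^ p * θ₃ ^ K := by ring

/-- **(γ) PRODUCED WITH (γ3) READ FROM ROW NE3.**  `couplingMismatch_radius` on row NE3's admissible data `R.dom` with
its hypothesis `he` discharged by `blockClose_of_localRate`: inputs = the representations of `γ^A`, `γ^B`, (γ1) `ι_K`,
run B's action `≤ vol·cA_K`, (γ2) `d_K` (row NE4), the deviation `W_K` ((0.31), `weightDev_of_discrete031`), row NE3's
`LocalRate R C₃ θ₃` + the liaison `hdom`, (γ4) `≤ vol·dK_K`.  OUTPUT: the END's binder `hγ` with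
`rγ_K = (ι_K + d_K)·cA_K + W_K·(cA_K·Crel·(C₃θ₃^K) + dK_K)`.  Every input is a hypothesis. [folklore] -/
theorem couplingMismatch_radius_of_localRate (R : Readings ι' Z) {C₃ θ₃ Crel : ℝ} (hloc : LocalRate R C₃ θ₃)
    (PX : ℕ → ℝ → σ → ι' → Finset X) (PY : ℕ → ℝ → σ → ι' → Finset Y) (blk : ℕ → ℝ → σ → ι' → X → Y)
    (wB ρB ρL : ℕ → ℝ → σ → ι' → X → ℝ) (wbar wA ρA : ℕ → ℝ → σ → ι' → Y → ℝ)
    {γA γB : ℕ → ℝ → σ → ι' → ℝ} {ιK d W cA dK : ℕ → ℝ}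
    (hblk : ∀ K t, |t| ≤ l₀ → ∀ τ ∈ T K \ Bad K t, ∀ v ∈ R.dom, ∀ x ∈ PX K t τ v, blk K t τ v x ∈ PY K t τ v)
    (hγB : ∀ K t, |t| ≤ l₀ → ∀ τ ∈ T K \ Bad K t, ∀ v ∈ R.dom,
      γB K t τ v = ∑ x ∈ PX K t τ v, (wB K t τ v x - w₀) * ρB K t τ v x)
    (hγA : ∀ K t, |t| ≤ l₀ → ∀ τ ∈ T K \ Bad K t, ∀ v ∈ R.dom,
      γA K t τ v = ∑ y ∈ PY K t τ v, (wA K t τ v y - w₀) * ρA K t τ v y)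
    (hι : ∀ K t, |t| ≤ l₀ → ∀ τ ∈ T K \ Bad K t, ∀ v ∈ R.dom, ∀ x ∈ PX K t τ v,
      |wB K t τ v x - wbar K t τ v (blk K t τ v x)| ≤ ιK K) (hι0 : ∀ K, 0 ≤ ιK K)
    (hρB : ∀ K t, |t| ≤ l₀ → ∀ τ ∈ T K \ Bad K t, ∀ v ∈ R.dom, ∀ x ∈ PX K t τ v, 0 ≤ ρB K t τ v x)
    (hAct : ∀ K t, |t| ≤ l₀ → ∀ τ ∈ T K \ Bad K t, ∀ v ∈ R.dom, ∑ x ∈ PX K t τ v, ρB K t τ v x ≤ vol * cA K)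
    (hd : ∀ K t, |t| ≤ l₀ → ∀ τ ∈ T K \ Bad K t, ∀ v ∈ R.dom, ∀ y ∈ PY K t τ v,
      |wbar K t τ v y - wA K t τ v y| ≤ d K) (hd0 : ∀ K, 0 ≤ d K)
    (hW : ∀ K t, |t| ≤ l₀ → ∀ τ ∈ T K \ Bad K t, ∀ v ∈ R.dom, ∀ y ∈ PY K t τ v, |wA K t τ v y - w₀| ≤ W K)
    (hW0 : ∀ K, 0 ≤ W K)
    (hdom : ∀ K t, |t| ≤ l₀ → ∀ τ ∈ T K \ Bad K t, ∀ v ∈ R.dom, ∀ Mloc : ℝ,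
      (∀ z : Z, |R.loc (K + 1) v z - R.loc K v z| ≤ Mloc) →
        ∑ y ∈ PY K t τ v, |(∑ x ∈ PX K t τ v with blk K t τ v x = y, ρB K t τ v x)
          - ∑ x ∈ PX K t τ v with blk K t τ v x = y, ρL K t τ v x| ≤ vol * cA K * Crel * Mloc)
    (hδ : ∀ K t, |t| ≤ l₀ → ∀ τ ∈ T K \ Bad K t, ∀ v ∈ R.dom,
      ∑ y ∈ PY K t τ v, |(∑ x ∈ PX K t τ v with blk K t τ v x = y, ρL K t τ v x) - ρA K t τ v y| ≤ vol * dK K) :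
    ∀ K t, |t| ≤ l₀ → ∀ τ ∈ T K \ Bad K t, ∀ v ∈ R.dom,
      |γB K t τ v - γA K t τ v| ≤ vol * ((ιK K + d K) * cA K + W K * (cA K * Crel * (C₃ * θ₃ ^ K) + dK K)) :=
  fun K t ht τ hτ v hv => by
  have h := couplingMismatch_radius (l₀ := l₀) (vol := vol) (w₀ := w₀) (Adm := R.dom)
    (eK := fun K => cA K * Crel * (C₃ * θ₃ ^ K)) PX PY blk wB ρB ρL wbar wA ρA hblk hγB hγA hι hι0 hρB hAct hd
    hd0 hW hW0 (blockClose_of_localRate R hloc PX PY blk ρB ρL hdom) hδ K t ht τ hτ v hv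
  simpa only using h

end NE3

end Summit.QuantumFields.BalabanUV.T4Continuum.TermwiseCouplingMismatch
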